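import Mathlib
import HarnessLib
import HarnessLib.Audit
import Summits.KontsevichZagierPeriods.Statement
import Literature.NumberTheory.Transcendental.KZKernelConjectureForms
import Literature.NumberTheory.Transcendental.KZRulesAssociator
import HarnessLib.Audit.Status.Attr

/-!
Route: RootDecompOrderCut

# Route RootDecompOrderCut — KZ is exactly defect-negligibility plus properness of the natural
preordering plus reducedness of the formal period ring

ROOT-DECOMP node (cell decomp-kz, lens 5 «finite range + asymptotic regime + bridge», generation 9 —
the ORDER CUT; critic decomp-kz-crit-1 g2
CLEARED 2026-08-30T09:50:52Z, score A9/B8/C9; sibling of route E″ RootDecompPureDefect, not an edit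
of it). On the formal period ring
P = KZ.FormalPeriodRing (= FormalRep ⧸ relations, character v = evalP) let T be the NATURAL
PREORDERING: the additive closure of the products
(positive class)·(square), a positive class being the class of ONE integral representation with
integrand ≥ 0 on its domain and value > 0
(a sign condition on the semialgebraic data). It suffices to show X = DefectNegligible ∧ ProperCone
∧ ReducedPeriodRing:
(DN) every defect x (v x = 0) has an even power with x^(2(m+1)) + t = 0 for some t ∈ T; (PC) T ∩ −T
= 0; (Red) P is reduced (shared item
stmt-KontsevichZagierPeriods-3929). The cut is EXACT (lens theorem summit_iff_nilOrder: S ⟺ DN ∧ PC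
∧ Red), EQUIV-free (no piece is S in
costume: three kernel models on the faithful interface separate every piece from S and from each
other), and 0540-free.
Lean: `DefectNegligible → ProperCone → ReducedPeriodRing → KontsevichZagierPeriods`

## Assembly
Pure commutative algebra plus the cited frame, kernel-checked in glue.lean (theorem closes, axioms
propext / Classical.choice / Quot.sound):
a defect x has x^(2(m+1)) + t = 0 with t ∈ T (DefectNegligible); x^(2(m+1)) = 1·(x^(m+1))² ∈ T
because 1 = ⟦[pt, 1]⟧ is a positive class
(IntegralRep.unit, value_unit, toFormalPeriod_of_unit); hence x^(2(m+1)) ∈ T ∩ −T = 0 (ProperCone);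
ReducedPeriodRing, read on P through
toFormalPeriod_surjective / toFormalPeriod_eq_zero_iff, peels the power (x^(2^k) = 0 → x = 0); the
frame KontsevichZagierPeriods_iff +
kzKernelConjecture_iff_isRational + evalP_toFormalPeriod + toFormalPeriod_eq_zero_iff turns «every
defect class is 0» into the summit.

Rationale: WHY THIS LINE. Mechanism: positivity INSIDE the Kontsevich–Zagier calculus. Value-positivity is
certified by moves — lens theorem posCertificate «0 < v g ⟹
(M+1)·g = 1 + c with c a positive class» (kernel, from the tree's sorry-free Viu-Sos compact
semi-canonical volume API, arXiv:1509.01097 /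
doi:10.1142/s179304212150007x, plus Archimedes; no Positivstellensatz assumed) — so every value
hypothesis in the forest's pieces becomes a cone
identity in P, and the summit reads S ⟺ «(P,T) has no non-zero order-infinitesimals»
(summit_iff_noInfinitesimals, value-free). Imported area:
real algebra / ordered rings (proper cones and supports of preorderings, doi:10.1007/3-540-33099-2
§2.1; the GKZ «vol injective on the real
semi-algebra» viewpoint of Cresson–Viu-Sos doi:10.5802/jtnb.1204) transplanted to the formal period
ring with the dictionary positive class ↦
generator of T, defect ideal ker v ↦ intersection of the supports of the T-orderings (DN), T-real ↦
PC ∧ Red. What it does that the 13 cell routes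
and the negatives index do not: ONE reality statement (PC) sits above the whole transcendence-type
residual of E″ (PC ⟹ K_ϖ = item 27509 ⟹
31137 ∧ 31138, lens theorem piConnected_of_properCone) while the flatness load drops from U_ϖ
(27508) / KernelNil to the strictly weaker DN,
a common floor of the flat and the nil branches (DN ⟸ U_ϖ, DN ⟸ KernelNil, kernel).

RANKED CRUXES. #2 DefectNegligible (crux) — every defect of the formal period ring has an even power
that is ≤_T 0: for x ∈ P with evalP x = 0 there are m and t in the natural preordering T = Σ
(positive class)·(square) with x^(2(m+1)) + t = 0 (lens-5 g9 piece DN; tags WEAKER · ATTACKABLE ·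
INSTRUMENTED; ⟸ item 27508 U_ϖ by defectNegligible_of_piFlatDefect, ⟸ KernelNil). [difficulty: XL]
(why it might fail: Fails only with S (S ⟹ DN, t = 0). As a target: ℝ[t] (v = ev₀) ⊨ PC ∧ Red ∧ ¬DN,
so DN needs period-specific input; outside the Γ-flat sector no U_ϖ/cone certificate is known, and
the equal-value non-isogenous Γ-pairs at N = 15, 20, 21, 28 are undecided.) [KontsevichZagier2001,
Ayoub2014, arXiv:1509.01097, doi:10.5802/jtnb.1204, doi:10.1007/3-540-33099-2,
stmt-KontsevichZagierPeriods-27508, stmt-KontsevichZagierPeriods-3742]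
#3 ProperCone (crux) — the natural preordering T of P is proper: t ∈ T and −t ∈ T force t = 0
(«moves un-sum a vanishing weighted sum of squares»); born text of item
stmt-KontsevichZagierPeriods-31891 VERBATIM (support r9 on E″; here load-bearing). Tags NEW PIECE ·
NEW AXIS (reality) · WEAKER · IDEA-NEEDED; PC ⟹ K_ϖ (27509) ⟹ 31137 ∧ 31138. [difficulty:
open-problem] (why it might fail: Fails only with S (S ⟹ PC proved). IDEA-NEEDED: no instrument
un-sums a vanishing weighted sum of squares by moves; 𝔐_alg = ℚ[X]×ℚ ⊨ DN ∧ Red ∧ ¬PC, so flatness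
alone cannot give it; a phantom T-ordering would live on an undecided equal-value Γ-pair (N = 15,
20, 21, 28).) [KontsevichZagier2001, Ayoub2014, HuberWustholz2022, doi:10.1007/3-540-33099-2,
doi:10.5802/jtnb.1204, stmt-KontsevichZagierPeriods-27509, stmt-KontsevichZagierPeriods-31891]
#4 ReducedPeriodRing (crux) — the formal period ring is reduced: c·c ∈ KZ.relations ⇒ c ∈
KZ.relations (= shared item stmt-KontsevichZagierPeriods-3929, route FurushoPentagon crux r3,
signature VERBATIM; registered line lin_stokes_sym). Tag WEAKER (⟸ U_ϖ ∧ C₀, lens g8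
reduced_of_flat_disc; 𝔑 = ℚ[X] ×_ℚ ℚ[ε]/ε² ⊨ DN ∧ PC ∧ ¬Red). [difficulty: L] (why it might fail: A
nilpotent = reps r, r′ with (r−r′)² a move chain to 0 but r ≁ r′; nothing in print either way — even
for Nori's effective formal period algebra reducedness is open (it would follow from injectivity P̃⁺
→ P̃⁺[1/2πi], HuberWustholz2022 App. A); only the summit implies it.) [Ayoub2014, HuberWustholz2022,
KontsevichZagier2001, Furusho2011, stmt-KontsevichZagierPeriods-3929]

TWO-LAYER PLAN. DefectNegligible ⇐ stub_flat (= item 27508 U_ϖ verbatim) → stub_posCert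
(posCertificate, lens THEOREM) → DefectNegligible — kernel-checked birth skeleton
(bc/DefectNegligible_birth.lean, DefectNegligible_of); once posCertificate lands as a Theorems file
the split is «DN ⇐ U_ϖ» by name. Foreseen sector
split of DN along E″'s: Γ-flat sector (rung PROVED theorem-fed: defectNegligible_rung_gamma) / the
rest. ProperCone: no split filed — every two-stub cut
tried (cone kernel → PC; T-real → PC; support ideal prime → PC) has a stub ≥ PC (costume); its first
informative instance is the Γ-sector statement
«Σ cᵢ(1−τ_Nᵢ)² ∈ −T ⟹ each (1−τ_Nᵢ)² = 0» for the undecided index-two involutions.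

KILL CRITERIA. A refutation of ProperCone (a t ≠ 0 in T ∩ −T: two positive-class-weighted sums of
squares of P adding to 0 by moves) or of DefectNegligible closes the
route outright (close --reason refuted:<Decl>) AND refutes the summit (each piece is S-implied,
kernel: properCone_of_summit / defectNegligible_of_summit /
reduced_of_summit) — either outcome is informative. A refutation of ReducedPeriodRing (3929)
likewise refutes S. A proof of item 27508 U_ϖ moots
DefectNegligible (edge U_ϖ ⟹ DN); a proof of KernelNil moots it too. If ProperCone is shown
EQUIVALENT to S given DN ∧ Red by a cheap argument the
route is a costume and is retired superseded by E″.

NOT DECOMPOSED YET. The Γ-sector / non-Γ split of DefectNegligible (layer-2 children, after the E″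
items 27508 / 3742 move); the accessibility inputs GammaUnitsModPi /
BetaUnitsModPi of the flat sector (evidence in the lens files, not items); any
Positivstellensatz-type normal form for T (not needed by closes; the
abstract Krivine–Stengle dictionary is a reading, not a dependency); landing of posCertificate and
piConnected_of_properCone as Theorems files
(lander asks on the bus, --supports 27509).

CHEAPEST FALSIFIER. In-Lean, run at filing: (i) the three C → S probes and the S → C converses
(bc/bc2_bc4.lean: C → S fail ×3 with unsolved goals at 400000 heartbeats;
converses elaborate — exact cut); (ii) #h21_crux_probe on the three pieces (bc/bc7.lean: VERDICT
CLEAN ×3, no battery timeout); (iii) the lens's 18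
must-fail probes incl. drop-one and piece → piece (HOME/decomp-kz-lens-5/g9/bc/mustfail_g9.json,
18/18 fail) and the three kernel models
𝔐_alg ⊨ DN ∧ Red ∧ ¬PC, ℝ[t] ⊨ PC ∧ Red ∧ ¬DN, 𝔑 ⊨ DN ∧ PC ∧ ¬Red
(Interface.order_pieces_independent, axioms std). Next cheapest for a refuter:
exhibit t ≠ 0 in T ∩ −T from two equal-value Γ-products at an undecided level N ∈ {15, 20, 21, 28}
(would refute PC and S at once).

NUMBERS. Undecided index-two involution levels of the Γ-sector: N = 15, 20, 21, 28 (item 3742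
GammaHodgeSector; census HOME/census/COSTUME-CENSUS-v7.md
sha256 20a9727c6cbbc266…). posCertificate constant: (M+1)·g = 1 + c with M = ⌈1/v g⌉-type
Archimedean bound (lens §12a). Kernel walls: bc2_bc4 122 s,
bc7 93 s, birth skeleton 29 s, rung 115 s, Sketch closes 6 s (remote lean-5 / lean-3).

DEFINITION REQUESTS. None: IsPosClass / posCone are lens-local and INLINED (δ-expanded) in the born
texts over Literature KZRulesAssociator vocabulary (FormalPeriodRing,
evalP, toFormalPeriod, of, IntegralRep.domain/integrand/value); ProperCone's text is Iff.rfl-equal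
to item 31891's (properConeBorn_iff in Sketch.lean).

Novelty: Searches (2026-08-30): lit search --hybrid "preordering positive cone ring of periods Kontsevich
Zagier" -n 8 and lit vsearch "the periods with a positive integrand form a cone / semiring; an
ordering on the ring of periods" -k 8 → no period-ring preordering hit; nearest held text
[corpus:paper:doi-10-5802-jtnb-1204 p.5, p.9] Cresson–Viu-Sos, GKZ conjecture «vol : K₀(CSA_ℝalg) →
P_kz^ℝ injective» (real semi-algebra of compact domains; positivity as VOLUME, no preordering /
support statement) and [corpus:paper:arxiv-1509.01097 p.20] Viu-Sos semi-canonical reduction (used,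
via the tree's KZVolumeConjectureProofs API); lit galaxy search "positive periods|cone of
periods|semiring of periods|ordering on periods" --star all -n 24 → 24 rows, 0 relevant [galaxy:
null]; real-algebra dictionary source [corpus:book:basu2006-algorithms-real-algebraic-geometry p.89]
(Prop. 2.6/2.8: proper cones, real fields ⟺ ΣF² proper); tree: rg -i
"posCone|preorder|Positivstellensatz|IsPosClass|sum of squares" over
lean/Summits/KontsevichZagierPeriods and Literature/NumberTheory/Transcendental → 0 hits outside the
lens file; HOME TREE.md v16 / CRITIC-LEDGER / census COSTUME-CENSUS-v7: no order or positivity lever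
in any of the 13 cell routes; ledger negatives --problem KontsevichZagierPeriods: 1 entry (stmt-5394
KinematicPlaneConvex), unrelated.
Nearest prior art found: route E″ RootDecompPureDefect (this cell: S ⟺ U_ϖ ∧ K_ϖ ∧ C₀ with item
31891 ProperCone filed beneath the residual as a rank-9 support  [refs: 10.5802/jtnb.1204, 10.1007/3-540-33099-2, 1509.01097, paper:doi-10-5802-jtnb-1204, paper:arxiv-1509.01097, book:basu2006-algorithms-real-algebraic-geometry, doi:10.5802/jtnb.1204, doi:10.1007/3-540-33099-2]

Barriers (technique_class: real-algebra, preordering, positivity, kernel-descent): - technique_class: real-algebra, preordering, positivity, kernel-descent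
- Literature.Barriers.KontsevichZagierPeriods.noSemialgebraicPrimitive_inv_sub_two: outside its
class — it obstructs producing move chains by fixed-variable Stokes primitives (no semialgebraic
primitive of 1/(x−2)); DN and PC GRANT the move identities in their hypotheses (t ∈ T, x^(2(m+1)) +
t = 0 are identities in P) and conclude identities, and posCertificate's moves are Viu-Sos
dissections + Archimedes, not primitives [corpus:paper:arxiv-1509.01097 p.20]; the barrier does not
quantify over order or sums of squares (no hits for "sum of squares|preordering" in
Literature/Barriers/KontsevichZagierPeriods).
- Literature.Barriers.KontsevichZagierPeriods.algebraicPrimitivesObstructionNarrow: same class, same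
answer — no item asks for a primitive in a fixed set of variables; the cone T is closed under the
full move congruence including new variables.
- Literature.Barriers.KontsevichZagierPeriods.kzConjecture_implies_oddZetaAlgIndep: inside, honestly
priced — any proof of S carries Grothendieck-strength transcendence (odd zeta values algebraically
independent); the cut LOCALISES it: PC carries the transcendence-type content (PC ⟹ K_ϖ ⟹ A ∧ B of
E″), DN carries none beyond flatness-type input (ℝ[t] shows it is not free, 𝔐_alg shows it is
algebraic in nature), Red is the nilpotence price shared with FurushoPentagon. The bet is pricing,
not evasion.
- Literature.Barriers.KontsevichZagierPeriods.kzConjecture_impl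

History (route lifecycle, newest last):
- 2026-08-30T11:33:14Z · rev 1: informal re-worded for ProperCone (planner-decomp-kz-writer-1-g4-0)

sub-problem: KontsevichZagierPeriods · status: draft · opened planner-decomp-kz-writer-1-g3-0 2026-08-30T10:26:50Z · rev 1 · ledger route-KontsevichZagierPeriods-RootDecompOrderCut
GENERATED by the gate from the ledger (D-0016/17). Provers cite these decls: `theorem foo : Summit.KontsevichZagierPeriods.KontsevichZagierPeriods.Theses.RootDecompOrderCut.<Decl> := …` in Summits/KontsevichZagierPeriods/KontsevichZagierPeriods/Theorems/<Name>.lean.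
-/

namespace Summit.KontsevichZagierPeriods.KontsevichZagierPeriods.Theses.RootDecompOrderCut

open scoped BigOperators Topology Manifold Classical MeasureTheory ProbabilityTheory Matrix InnerProductSpace ComplexConjugate ContinuousMap
open Filter Set Function TopologicalSpace MeasureTheory

attribute [summit_statement] _root_.KontsevichZagierPeriods

open Literature Periods

/-- item stmt-KontsevichZagierPeriods-32161 · crux · rank 2 · open · by planner
why it might fail: Fails only with S (S ⟹ DN, t = 0). As a target: ℝ[t] (v = ev₀) ⊨ PC ∧ Red ∧ ¬DN, so DN needs period-specific input; outside the Γ-flat sector no U_ϖ/cone certificate is known, and the equal-value non-isogenous Γ-pairs at N = 15, 20, 21, 28 are undecided.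
sources: KontsevichZagier2001, Ayoub2014, arXiv:1509.01097, doi:10.5802/jtnb.1204, doi:10.1007/3-540-33099-2, stmt-KontsevichZagierPeriods-27508
[crux] every defect of the formal period ring has an even power that is ≤_T 0: for x ∈ P with evalP
x = 0 there are m and t in the natural preordering T = Σ (positive class)·(square) with x^(2(m+1)) +
t = 0 (lens-5 g9 piece DN; tags WEAKER · ATTACKABLE · INSTRUMENTED; ⟸ item 27508 U_ϖ by
defectNegligible_of_piFlatDefect, ⟸ KernelNil). [difficulty: XL] -/
@[route_item "route-KontsevichZagierPeriods-RootDecompOrderCut", crux]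
def DefectNegligible : Prop :=
  ∀ x : Literature.NumberTheory.Transcendental.KZ.FormalPeriodRing, Literature.NumberTheory.Transcendental.KZ.evalP x = 0 → ∃ (m : ℕ) (t : Literature.NumberTheory.Transcendental.KZ.FormalPeriodRing), t ∈ AddSubmonoid.closure {y : Literature.NumberTheory.Transcendental.KZ.FormalPeriodRing | ∃ c p : Literature.NumberTheory.Transcendental.KZ.FormalPeriodRing, (∃ (N : ℕ) (r : Literature.NumberTheory.Transcendental.KZ.IntegralRep N), (∀ z ∈ r.domain, 0 ≤ r.integrand z) ∧ 0 < r.value ∧ Literature.NumberTheory.Transcendental.KZ.toFormalPeriod (Literature.NumberTheory.Transcendental.KZ.of r) = c) ∧ y = c * (p * p)} ∧ x ^ (2 * (m + 1)) + t = 0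

/-- item stmt-KontsevichZagierPeriods-31891 · crux · rank 3 · open · by planner
why it might fail: Fails only with S (S ⟹ PC proved). IDEA-NEEDED: no instrument un-sums a vanishing weighted sum of squares by moves; 𝔐_alg = ℚ[X]×ℚ ⊨ DN ∧ Red ∧ ¬PC, so flatness alone cannot give it; a phantom T-ordering would live on an undecided equal-value Γ-pair (N = 15, 20, 21, 28).
sources: KontsevichZagier2001, Ayoub2014, HuberWustholz2022, doi:10.1007/3-540-33099-2, doi:10.5802/jtnb.1204, stmt-KontsevichZagierPeriods-27509
[crux · rank 3 on route O RootDecompOrderCut (S ⟸ DefectNegligible 32161 ∧ ProperCone ∧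
ReducedPeriodRing 3929, EXACT: summit_iff_orderCut; born 2026-08-30T10:27Z rev 0 126406117d34) ·
ALSO support · rank 9 on route E″ RootDecompPureDefect beneath K_ϖ = 27509 PiConnected (ProperCone ⟹
PiConnected ⟹ 31137 ∧ 31138, piConnected_of_properCone, kernel) · tags NEW PIECE · NEW AXIS (reality
/ positivity INSIDE the calculus) · WEAKER (S ⟹ PC: properCone_of_summit; PC ⟹ S fails in the
interface models 𝔑 = ℚ[X]×_ℚ ℚ[ε]/ε² ⊨ PC ∧ ¬S, ℝ[X] ⊨ PC ∧ ¬S; 𝔐_alg ⊨ ¬PC; acnode model ℝ[X,Y]/(Y²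
+ X²(X−1))-type reduced domain with PosCert ∧ DN ∧ ¬PC, lens-5 g10 §13b) · IDEA-NEEDED · T3 =
PLAN-ONLY + MODELS (lens-5 g10 §13c verdict, kernel: sqRoot_torsion_of_properCone,
indexTwo_torsion_of_properCone — on every index-two Das/Γ pair ProperCone ALONE already yields the
pair identity, i.e. every Γ-instance of PC is an S-instance: NO BC5 rung of PC exists on the
Γ-sector outside S's known regime; the BC3 two-stub cuts tried by writer g3 were all ≥ PC = costume,
none filed) · verdicts: critic decomp-kz-crit-1 g2 CLEARED 2026-08-30T09:50:52Z (lens-5 g9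
PureDefect @2f18c7f1, A9/B8/C9) and 11:03:23Z (lens-5 g10 -/
@[route_item "route-KontsevichZagierPeriods-RootDecompOrderCut", crux]
def ProperCone : Prop :=
  ∀ t : Literature.NumberTheory.Transcendental.KZ.FormalPeriodRing, t ∈ AddSubmonoid.closure {y : Literature.NumberTheory.Transcendental.KZ.FormalPeriodRing | ∃ c p : Literature.NumberTheory.Transcendental.KZ.FormalPeriodRing, (∃ (N : ℕ) (r : Literature.NumberTheory.Transcendental.KZ.IntegralRep N), (∀ z ∈ r.domain, 0 ≤ r.integrand z) ∧ 0 < r.value ∧ Literature.NumberTheory.Transcendental.KZ.toFormalPeriod (Literature.NumberTheory.Transcendental.KZ.of r) = c) ∧ y = c * (p * p)} → -t ∈ AddSubmonoid.closure {y : Literature.NumberTheory.Transcendental.KZ.FormalPeriodRing | ∃ c p : Literature.NumberTheory.Transcendental.KZ.FormalPeriodRing, (∃ (N : ℕ) (r : Literature.NumberTheory.Transcendental.KZ.IntegralRep N), (∀ z ∈ r.domain, 0 ≤ r.integrand z) ∧ 0 < r.value ∧ Literature.NumberTheory.Transcendental.KZ.toFormalPeriod (Literature.NumberTheory.Transcendental.KZ.of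 r) = c) ∧ y = c * (p * p)} → t = 0

/-- item stmt-KontsevichZagierPeriods-3929 · crux · rank 4 · open · by planner
why it might fail: A nilpotent = reps r, r′ with (r−r′)² a move chain to 0 but r ≁ r′; nothing in print either way — even for Nori's effective formal period algebra reducedness is open (it would follow from injectivity P̃⁺ → P̃⁺[1/2πi], HuberWustholz2022 App. A); only the summit implies it.
sources: Ayoub2014, HuberWustholz2022, KontsevichZagier2001, Furusho2011, stmt-KontsevichZagierPeriods-3929
[crux] the formal period ring P = KZ.FormalRep ⧸ KZ.relations has no nilpotents: c·c ∈ KZ.relations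
⇒ c ∈ KZ.relations (product = Fubini product of representations, KZProduct.lean). Card item (d)
ReducedOrF1, branch F2; the exact algebraic price of running Furusho's field-level theorem over P_ℚ.
[difficulty: L] -/
@[route_item "route-KontsevichZagierPeriods-RootDecompOrderCut", crux]
def ReducedPeriodRing : Prop :=
  ∀ c : Literature.NumberTheory.Transcendental.KZ.FormalRep, c * c ∈ Literature.NumberTheory.Transcendental.KZ.relations → c ∈ Literature.NumberTheory.Transcendental.KZ.relations

/-- item stmt-KontsevichZagierPeriods-32162 · assembly · rank 1 · open · by planner
sources: KontsevichZagier2001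
[assembly] DefectNegligible → ProperCone → ReducedPeriodRing → KontsevichZagierPeriods (schema item;
the deciding theorem is `closes` in glue.lean). -/
@[route_item "route-KontsevichZagierPeriods-RootDecompOrderCut"]
def Assembly : Prop :=
  DefectNegligible → ProperCone → ReducedPeriodRing → KontsevichZagierPeriods

/-! D-0027 §2.1 — DECIDING THEOREM (planner-authored via `route open/edit --closes-file`; by planner-decomp-kz-writer-1-g3-0 2026-08-30T10:26:50Z):
its hypotheses are this route's items and its conclusion the sub-problem Statement (glue_lint), and it elaborates with this file. -/

-- glue.lean — deciding theorem for route RootDecompOrderCut (decomp-kz lens 5, generation 9 ORDER CUT; writer g3).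
-- Self-contained over the Literature KZ vocabulary: a defect x = ⟦c⟧ (evalP x = 0) has, by DefectNegligible,
-- x^(2(m+1)) + t = 0 with t in the natural preordering T = Σ (positive class)·(square); x^(2(m+1)) = (x^(m+1))²
-- lies in T because 1 = ⟦[pt,1]⟧ is a positive class; so x^(2(m+1)) ∈ T ∩ −T = 0 (ProperCone); reducedness of
-- P (item 3929, read on P through toFormalPeriod) peels the power; the cited frame KontsevichZagierPeriods_iff +
-- kzKernelConjecture_iff_isRational + toFormalPeriod_eq_zero_iff translates `c ∈ relations` into the summit.
@[closes "route-KontsevichZagierPeriods-RootDecompOrderCut"] theorem closes (hDN : DefectNegligible) (hPC : ProperCone) (hRed : ReducedPeriodRing) :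
    _root_.KontsevichZagierPeriods := by
  have hRedP : ∀ x : Literature.NumberTheory.Transcendental.KZ.FormalPeriodRing, x * x = 0 → x = 0 := by
    intro x hx
    obtain ⟨c, rfl⟩ := Literature.NumberTheory.Transcendental.KZ.toFormalPeriod_surjective x
    rw [← map_mul, Literature.NumberTheory.Transcendental.KZ.toFormalPeriod_eq_zero_iff] at hx
    exact Literature.NumberTheory.Transcendental.KZ.toFormalPeriod_eq_zero_iff.mpr (hRed c hx)
  have hpow : ∀ (k : ℕ) (x : Literature.NumberTheory.Transcendental.KZ.FormalPeriodRing), x ^ (2 ^ k) = 0 → x = 0 := by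
    intro k
    induction k with
    | zero => intro x h; rwa [pow_zero, pow_one] at h
    | succ k ih =>
      intro x h
      apply ih
      apply hRedP
      rw [← pow_add, ← two_mul, ← pow_succ']
      exact h
  have hpow' : ∀ (n : ℕ) (x : Literature.NumberTheory.Transcendental.KZ.FormalPeriodRing), x ^ (n + 1) = 0 → x = 0 := fun n x h =>
    hpow (n + 1) x (pow_eq_zero_of_le Nat.lt_two_pow_self.le h)
  have h1pos : ∃ (N : ℕ) (r : Literature.NumberTheory.Transcendental.KZ.IntegralRep N), (∀ z ∈ r.domain, 0 ≤ r.integrand z) ∧ 0 < r.value ∧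
      Literature.NumberTheory.Transcendental.KZ.toFormalPeriod (Literature.NumberTheory.Transcendental.KZ.of r) = 1 :=
    ⟨0, Literature.NumberTheory.Transcendental.KZ.IntegralRep.unit, fun z _ => by simp, by rw [Literature.NumberTheory.Transcendental.KZ.IntegralRep.value_unit]; exact one_pos,
      Literature.NumberTheory.Transcendental.KZ.toFormalPeriod_of_unit⟩
  rw [KontsevichZagierPeriods_iff, ← Literature.NumberTheory.Transcendental.kzKernelConjecture_iff_isRational]
  intro c hc
  apply Literature.NumberTheory.Transcendental.KZ.toFormalPeriod_eq_zero_iff.mp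
  set x : Literature.NumberTheory.Transcendental.KZ.FormalPeriodRing := Literature.NumberTheory.Transcendental.KZ.toFormalPeriod c with hxdef
  have hx : Literature.NumberTheory.Transcendental.KZ.evalP x = 0 := by
    rw [hxdef, Literature.NumberTheory.Transcendental.KZ.evalP_toFormalPeriod]
    exact hc
  obtain ⟨m, t, ht, hmt⟩ := hDN x hx
  have h0 : x ^ (2 * (m + 1)) = 0 := by
    refine hPC _ ?_ ?_
    · rw [pow_mul', sq]
      exact AddSubmonoid.subset_closure ⟨1, x ^ (m + 1), h1pos, by rw [one_mul]⟩
    · rw [neg_eq_of_add_eq_zero_right hmt]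
      exact ht
  exact hpow' (2 * m + 1) x (by rw [show 2 * m + 1 + 1 = 2 * (m + 1) by ring]; exact h0)

end Summit.KontsevichZagierPeriods.KontsevichZagierPeriods.Theses.RootDecompOrderCut
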